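import Summits.CriticalPhenomena.PercolationContinuityZ3.Theorems.PercNearOneGluingNoHeavyQuantLawDecFlows
import HarnessLib

/-!
# QUANT lane R8, T-DEC: the FLOW NORMAL FORM of DEC(j′), part 2 — flows yield a valid decomposition; `DECAtT ⟺ FlowAtT`

builds on p205010 (kernel theorem, internal audit signed; external expert review pending)

Support file (`--supports stmt-CriticalPhenomena-4575`), QUANT lane typer seat prim-quant-stmt (gen 22), rung R8 of
`run/shared/lean/prim/quant/LADDER.md`.  Theorems only, standard axioms, no sorries.  Part 1 is `…QuantLawDecFlows` (`LawDec.pairGate`,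
`LawDec.gateOf`, `LawDec.usage`, `LawDec.FlowAtT`, necessity `flowAtT_of_decAtT`, weak duality `dual_le_of_decAtT`).

* **`LawDec.decAtT_of_flowAtT`** (sufficiency; law facts `μ = 0` above `M`, mass `1`; `0 < x < 1`): the decomposition indexed by
  `(Fin (j′+1) × Fin (M+1)) ⊕ Fin (M+1)` — every used pair `(l, h)` at its minimal gate `gateOf` with weight `f l h/(1 − gateOf)` (valid by rule
  (G) for giants, by `LawDec.validAt_creditPair` for mids), and at every atom `h ≤ M` a point mass carrying the leftover `μ h − Σ_l usage·f l h`
  (zero on low atoms; valid by rule (S) elsewhere).  Bookkeeping as in prim-quant-census-2 g52's `LawDec.rest_of_flows`.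
* **`LawDec.decAtT_iff_flowAtT`**, **`LawDec.decAt_iff_flowAt`** — DEC(j′) (at a target / at the mean) IS the flow form.

[this work]; DEC rules ARCH-TREES-G49 §2.2 / DEC-TAMP-G50 §3.1, §3.4 (‡) (this lane).  The gluing rows served
[cite: KozmaNitzan2024, Conjecture 3 (p. 15)]; product measure [cite: Grimmett1999, §1.3 p. 10].
-/

noncomputable section

namespace Summit.CriticalPhenomena.PercolationContinuityZ3.Theorems

namespace Quant

open Finset

/-- the two-point law `{lo, hi; g}` (as in `…QuantLawDEC`) -/
local notation3 "TP[" lo ", " hi ", " g ", " h "]" =>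
  (g : ℝ) * (if (h : ℕ) = (hi : ℕ) then (1 : ℝ) else 0) + (1 - (g : ℝ)) * (if (h : ℕ) = (lo : ℕ) then (1 : ℝ) else 0)

namespace LawDec

/-! ### Sufficiency: flows yield a valid decomposition -/

/-- a two-point law with both atoms in `{0..M}` has mass `1` there. [folklore] -/
theorem sum_TP_range (M lo hi : ℕ) (g : ℝ) (hlo : lo ≤ M) (hhi : hi ≤ M) :
    ∑ t ∈ Finset.range (M + 1), TP[lo, hi, g, t] = 1 := by
  rw [Finset.sum_add_distrib, ← Finset.mul_sum, ← Finset.mul_sum,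
    Finset.sum_ite_eq' (Finset.range (M + 1)) hi, Finset.sum_ite_eq' (Finset.range (M + 1)) lo,
    if_pos (Finset.mem_range.2 (Nat.lt_succ_of_le hhi)), if_pos (Finset.mem_range.2 (Nat.lt_succ_of_le hlo))]
  ring

/-- the total weight of a mixture supported in `{0..M}` is the mass of the law on `{0..M}`. [folklore] -/
theorem sum_weights_eq_mass {ρ : Type} [Fintype ρ] (M : ℕ) (μ : ℕ → ℝ) (lam g : ρ → ℝ) (lo hi : ρ → ℕ)
    (hlo : ∀ r, lo r ≤ M) (hhi : ∀ r, hi r ≤ M) (hμ : ∀ h, μ h = ∑ r, lam r * TP[lo r, hi r, g r, h]) :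
    ∑ r, lam r = ∑ h ∈ Finset.range (M + 1), μ h := by
  rw [Finset.sum_congr rfl (fun h _ => hμ h), Finset.sum_comm]
  refine Finset.sum_congr rfl fun r _ => ?_
  rw [← Finset.mul_sum, sum_TP_range M (lo r) (hi r) (g r) (hlo r) (hhi r), mul_one]

/-- **THE FLOW FORM ⟹ DEC(j′) AT TARGET `T`** for a law `μ` on `{0..M}` of mass `1` (`0 < x < 1`; nonnegativity of `μ` is implied by the
flow form): pairs at their minimal gates, leftover mass as self-sufficient points.  See the file header. [this work] -/
theorem decAtT_of_flowAtT (x T : ℝ) (j' M : ℕ) (μ : ℕ → ℝ) (hx0 : 0 < x) (hx1 : x < 1)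
    (hμM : ∀ h, M < h → μ h = 0) (hμ1 : ∑ h ∈ Finset.range (M + 1), μ h = 1)
    (h : FlowAtT x T j' M μ) : DECAtT x T j' M μ := by
  classical
  obtain ⟨f, hf0, hsupp, hlow, hcap⟩ := h
  -- facts about used pairs
  have hpair : ∀ l h, 0 < f l h → l < h ∧ 0 < gateOf x T j' l h ∧ gateOf x T j' l h < 1 := by
    intro l h hp
    obtain ⟨hlj, hl2, _, hc⟩ := hsupp l h hp
    by_cases hgi : j' + 1 ≤ h
    · simp only [gateOf, if_pos hgi]
      exact ⟨by omega, hx0, hx1⟩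
    · simp only [gateOf, if_neg hgi]
      have hc' : T < (l : ℝ) + h := hc.resolve_left hgi
      have hlt : l < h := by
        have : (l : ℝ) < h := by linarith
        exact_mod_cast this
      exact ⟨hlt, pairGate_pos x T l h hl2 hlt, pairGate_lt_one x T l h hx0 hx1 hl2 hc'⟩
  have hf_zero : ∀ l h, ¬ (l ≤ j' ∧ 2 * (l : ℝ) < T ∧ h ≤ M ∧ (j' + 1 ≤ h ∨ T < (l : ℝ) + h)) → f l h = 0 := by
    intro l h hn
    by_contra hne
    exact hn (hsupp l h (lt_of_le_of_ne (hf0 l h) (Ne.symm hne)))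
  -- no flow into a low atom, no flow out of a non-low atom
  have hin_low : ∀ l t, t ≤ j' → 2 * (t : ℝ) < T → f l t = 0 := by
    intro l t htj ht2
    refine hf_zero l t ?_
    rintro ⟨_, hl2, _, hc⟩
    rcases hc with hc | hc
    · omega
    · linarith
  have hout_nonlow : ∀ t h, ¬ (t ≤ j' ∧ 2 * (t : ℝ) < T) → f t h = 0 := by
    intro t h hn
    exact hf_zero t h (fun hc => hn ⟨hc.1, hc.2.1⟩)
  -- the split of a pair weight into its low and high parts
  have hsplit : ∀ l h, f l h / (1 - gateOf x T j' l h) = f l h + usage x T j' l h * f l h := by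
    intro l h
    rcases (hf0 l h).eq_or_lt with hz | hp
    · rw [← hz]; simp
    · have h1 : 1 - gateOf x T j' l h ≠ 0 := by linarith [(hpair l h hp).2.2]
      simp only [usage]
      field_simp
      ring
  -- THE DECOMPOSITION
  refine ⟨(Fin (j' + 1) × Fin (M + 1)) ⊕ Fin (M + 1), inferInstance,
    Sum.elim (fun p => f p.1 p.2 / (1 - gateOf x T j' p.1 p.2))
      (fun h => if (h : ℕ) ≤ j' ∧ 2 * ((h : ℕ) : ℝ) < T then 0
        else μ h - ∑ l ∈ Finset.range (j' + 1), usage x T j' l h * f l h),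
    Sum.elim (fun p => if 0 < f p.1 p.2 then gateOf x T j' p.1 p.2 else 0) (fun _ => 1),
    Sum.elim (fun p => min (p.1 : ℕ) p.2) (fun h => (h : ℕ)), Sum.elim (fun p => (p.2 : ℕ)) (fun h => (h : ℕ)),
    ?_, ?_, ?_, ?_, ?_, ?_, ?_⟩
  · -- nonnegativity
    rintro (p | h)
    · dsimp only [Sum.elim_inl]
      rcases (hf0 p.1 p.2).eq_or_lt with hz | hp
      · rw [← hz, zero_div]
      · exact div_nonneg (hf0 _ _) (by linarith [(hpair _ _ hp).2.2])
    · dsimp only [Sum.elim_inr]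
      split_ifs with hl
      · exact le_rfl
      · exact sub_nonneg.2 (hcap h (Nat.lt_succ_iff.1 h.isLt) (by
          by_cases hj : j' + 1 ≤ (h : ℕ)
          · exact Or.inl hj
          · exact Or.inr (not_lt.1 fun hlt => hl ⟨by omega, hlt⟩)))
  · -- total weight (from the mixture identity proved below, but we prove it directly)
    rw [Fintype.sum_sum_type, Fintype.sum_prod_type]
    show (∑ p₁ : Fin (j' + 1), ∑ p₂ : Fin (M + 1), f (p₁ : ℕ) (p₂ : ℕ) / (1 - gateOf x T j' (p₁ : ℕ) (p₂ : ℕ))) +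
      ∑ h : Fin (M + 1), (if (h : ℕ) ≤ j' ∧ 2 * ((h : ℕ) : ℝ) < T then 0 else
        μ h - ∑ l ∈ Finset.range (j' + 1), usage x T j' l h * f l h) = 1
    rw [Fin.sum_univ_eq_sum_range (fun l => ∑ p₂ : Fin (M + 1), f l (p₂ : ℕ) / (1 - gateOf x T j' l (p₂ : ℕ))) (j' + 1)]
    rw [Fin.sum_univ_eq_sum_range (fun h => if h ≤ j' ∧ 2 * (h : ℝ) < T then (0 : ℝ) else
        μ h - ∑ l ∈ Finset.range (j' + 1), usage x T j' l h * f l h) (M + 1)]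
    have e1 : ∀ l, (∑ p₂ : Fin (M + 1), f l (p₂ : ℕ) / (1 - gateOf x T j' l (p₂ : ℕ))) =
        ∑ h ∈ Finset.range (M + 1), f l h / (1 - gateOf x T j' l h) := fun l =>
      Fin.sum_univ_eq_sum_range (fun h => f l h / (1 - gateOf x T j' l h)) (M + 1)
    simp only [e1]
    rw [Finset.sum_congr rfl (fun l _ => Finset.sum_congr rfl (fun h _ => hsplit l h))]
    simp only [Finset.sum_add_distrib]
    rw [Finset.sum_comm (f := fun l h => usage x T j' l h * f l h), add_assoc, ← Finset.sum_add_distrib]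
    -- Σ_l Σ_h f l h = Σ_{low l ≤ j'} μ l ; Σ_h (load + point) = Σ_{non-low h ≤ M} μ h
    have eL : ∑ l ∈ Finset.range (j' + 1), ∑ h ∈ Finset.range (M + 1), f l h
        = ∑ l ∈ Finset.range (j' + 1), (if l ≤ j' ∧ 2 * (l : ℝ) < T then μ l else 0) := by
      refine Finset.sum_congr rfl fun l hl => ?_
      have hlj : l ≤ j' := Nat.lt_succ_iff.1 (Finset.mem_range.1 hl)
      by_cases hlow' : 2 * (l : ℝ) < T
      · rw [if_pos ⟨hlj, hlow'⟩, hlow l hlj hlow']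
      · rw [if_neg (fun hc => hlow' hc.2)]
        exact Finset.sum_eq_zero fun h _ => hout_nonlow l h (fun hc => hlow' hc.2)
    have eH : ∑ h ∈ Finset.range (M + 1), (∑ l ∈ Finset.range (j' + 1), usage x T j' l h * f l h +
        (if h ≤ j' ∧ 2 * (h : ℝ) < T then (0 : ℝ) else μ h - ∑ l ∈ Finset.range (j' + 1), usage x T j' l h * f l h))
        = ∑ h ∈ Finset.range (M + 1), (if h ≤ j' ∧ 2 * (h : ℝ) < T then 0 else μ h) := by
      refine Finset.sum_congr rfl fun h _ => ?_
      by_cases hl : h ≤ j' ∧ 2 * (h : ℝ) < T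
      · rw [if_pos hl, if_pos hl, add_zero]
        exact Finset.sum_eq_zero fun l _ => by rw [hin_low l h hl.1 hl.2, mul_zero]
      · rw [if_neg hl, if_neg hl]; ring
    rw [eL, eH]
    -- both index ranges can be taken to be `range (max ...)`: extend each to a common range using vanishing
    have eL' : ∑ l ∈ Finset.range (j' + 1), (if l ≤ j' ∧ 2 * (l : ℝ) < T then μ l else 0)
        = ∑ l ∈ Finset.range (M + 1), (if l ≤ j' ∧ 2 * (l : ℝ) < T then μ l else 0) := by
      rcases le_or_gt j' M with hjM | hMj
      · rw [Finset.range_eq_Ico, Finset.range_eq_Ico,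
          ← Finset.sum_Ico_consecutive _ (Nat.zero_le (j' + 1)) (by omega : j' + 1 ≤ M + 1)]
        have : ∑ l ∈ Finset.Ico (j' + 1) (M + 1), (if l ≤ j' ∧ 2 * (l : ℝ) < T then μ l else 0) = 0 :=
          Finset.sum_eq_zero fun l hl => by
            rw [Finset.mem_Ico] at hl
            rw [if_neg (fun hc => by omega)]
        rw [this, add_zero]
      · rw [Finset.range_eq_Ico, Finset.range_eq_Ico,
          ← Finset.sum_Ico_consecutive _ (Nat.zero_le (M + 1)) (by omega : M + 1 ≤ j' + 1)]
        have : ∑ l ∈ Finset.Ico (M + 1) (j' + 1), (if l ≤ j' ∧ 2 * (l : ℝ) < T then μ l else 0) = 0 :=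
          Finset.sum_eq_zero fun l hl => by
            rw [Finset.mem_Ico] at hl
            split_ifs
            · exact hμM l (by omega)
            · rfl
        rw [this, add_zero]
    rw [eL', ← Finset.sum_add_distrib, ← hμ1]
    refine Finset.sum_congr rfl fun h _ => ?_
    split_ifs <;> ring
  · -- gates in [0,1]
    rintro (p | h)
    · dsimp only [Sum.elim_inl]
      split_ifs with hp
      · exact ⟨(hpair _ _ hp).2.1.le, (hpair _ _ hp).2.2.le⟩
      · exact ⟨le_rfl, zero_le_one⟩
    · exact ⟨zero_le_one, le_rfl⟩
  · rintro (p | h)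
    · exact min_le_right _ _
    · exact le_rfl
  · rintro (p | h)
    · exact Nat.lt_succ_iff.1 p.2.isLt
    · exact Nat.lt_succ_iff.1 h.isLt
  · -- mixture identity
    intro t
    rw [Fintype.sum_sum_type, Fintype.sum_prod_type]
    show μ t =
      (∑ p₁ : Fin (j' + 1), ∑ p₂ : Fin (M + 1),
        f (p₁ : ℕ) (p₂ : ℕ) / (1 - gateOf x T j' (p₁ : ℕ) (p₂ : ℕ)) *
          TP[min (p₁ : ℕ) (p₂ : ℕ), (p₂ : ℕ), (if 0 < f (p₁ : ℕ) (p₂ : ℕ) then gateOf x T j' (p₁ : ℕ) (p₂ : ℕ) else 0), t]) +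
      ∑ h : Fin (M + 1), (if (h : ℕ) ≤ j' ∧ 2 * ((h : ℕ) : ℝ) < T then 0 else
        μ h - ∑ l ∈ Finset.range (j' + 1), usage x T j' l h * f l h) * TP[(h : ℕ), (h : ℕ), (1 : ℝ), t]
    rw [Fin.sum_univ_eq_sum_range (fun l => ∑ p₂ : Fin (M + 1),
        f l (p₂ : ℕ) / (1 - gateOf x T j' l (p₂ : ℕ)) *
          TP[min l (p₂ : ℕ), (p₂ : ℕ), (if 0 < f l (p₂ : ℕ) then gateOf x T j' l (p₂ : ℕ) else 0), t]) (j' + 1)]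
    rw [Fin.sum_univ_eq_sum_range (fun h => (if h ≤ j' ∧ 2 * (h : ℝ) < T then (0 : ℝ) else
        μ h - ∑ l ∈ Finset.range (j' + 1), usage x T j' l h * f l h) * TP[h, h, (1 : ℝ), t]) (M + 1)]
    have e1 : ∀ l, (∑ p₂ : Fin (M + 1), f l (p₂ : ℕ) / (1 - gateOf x T j' l (p₂ : ℕ)) *
          TP[min l (p₂ : ℕ), (p₂ : ℕ), (if 0 < f l (p₂ : ℕ) then gateOf x T j' l (p₂ : ℕ) else 0), t]) =
        ∑ h ∈ Finset.range (M + 1), f l h / (1 - gateOf x T j' l h) *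
          TP[min l h, h, (if 0 < f l h then gateOf x T j' l h else 0), t] := fun l =>
      Fin.sum_univ_eq_sum_range (fun h => f l h / (1 - gateOf x T j' l h) *
          TP[min l h, h, (if 0 < f l h then gateOf x T j' l h else 0), t]) (M + 1)
    simp only [e1]
    have e2 : ∀ l h, f l h / (1 - gateOf x T j' l h) * TP[min l h, h, (if 0 < f l h then gateOf x T j' l h else 0), t]
        = (usage x T j' l h * f l h) * (if t = h then (1 : ℝ) else 0) + f l h * (if t = l then (1 : ℝ) else 0) := by
      intro l h
      rcases (hf0 l h).eq_or_lt with hz | hp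
      · rw [← hz]; simp
      · rw [if_pos hp, min_eq_left (hpair l h hp).1.le]
        have h1 : 1 - gateOf x T j' l h ≠ 0 := by linarith [(hpair l h hp).2.2]
        have hk : f l h / (1 - gateOf x T j' l h) * (1 - gateOf x T j' l h) = f l h := div_mul_cancel₀ _ h1
        have hu : usage x T j' l h * f l h = gateOf x T j' l h * (f l h / (1 - gateOf x T j' l h)) := by
          simp only [usage]; field_simp
        rw [hu]
        calc f l h / (1 - gateOf x T j' l h) * TP[l, h, gateOf x T j' l h, t]
            = gateOf x T j' l h * (f l h / (1 - gateOf x T j' l h)) * (if t = h then (1 : ℝ) else 0)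
              + (f l h / (1 - gateOf x T j' l h) * (1 - gateOf x T j' l h)) * (if t = l then (1 : ℝ) else 0) := by ring
          _ = _ := by rw [hk]
    rw [Finset.sum_congr rfl (fun l _ => Finset.sum_congr rfl (fun h _ => e2 l h))]
    simp only [Finset.sum_add_distrib]
    rw [Finset.sum_comm (f := fun l h => (usage x T j' l h * f l h) * (if t = h then (1 : ℝ) else 0))]
    simp only [← Finset.sum_mul]
    rw [sum_indicator (fun h => ∑ l ∈ Finset.range (j' + 1), usage x T j' l h * f l h) (M + 1) t]
    rw [sum_indicator (fun l => ∑ h ∈ Finset.range (M + 1), f l h) (j' + 1) t]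
    have e4 : ∀ h : ℕ, (if h ≤ j' ∧ 2 * (h : ℝ) < T then (0 : ℝ) else
        μ h - ∑ l ∈ Finset.range (j' + 1), usage x T j' l h * f l h) * TP[h, h, (1 : ℝ), t]
        = (if h ≤ j' ∧ 2 * (h : ℝ) < T then (0 : ℝ) else
          μ h - ∑ l ∈ Finset.range (j' + 1), usage x T j' l h * f l h) * (if t = h then (1 : ℝ) else 0) := by
      intro h; ring
    simp only [e4]
    rw [sum_indicator (fun h => if h ≤ j' ∧ 2 * (h : ℝ) < T then (0 : ℝ) else
        μ h - ∑ l ∈ Finset.range (j' + 1), usage x T j' l h * f l h) (M + 1) t]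
    by_cases htl : t ≤ j' ∧ 2 * (t : ℝ) < T
    · -- a low atom: shipped exactly, receives nothing, no point mass
      have hrecv : ∑ l ∈ Finset.range (j' + 1), usage x T j' l t * f l t = 0 :=
        Finset.sum_eq_zero fun l _ => by rw [hin_low l t htl.1 htl.2, mul_zero]
      rw [if_pos (Nat.lt_succ_of_le htl.1), hlow t htl.1 htl.2]
      by_cases htM : t < M + 1
      · rw [if_pos htM, if_pos htM, hrecv, if_pos htl]; ring
      · rw [if_neg htM, if_neg htM]; ring
    · -- a non-low atom
      have hship : ∑ h ∈ Finset.range (M + 1), f t h = 0 :=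
        Finset.sum_eq_zero fun h _ => hout_nonlow t h htl
      by_cases htM : t < M + 1
      · rw [if_pos htM, if_pos htM, if_neg htl]
        by_cases htj : t < j' + 1
        · rw [if_pos htj, hship]; ring
        · rw [if_neg htj]; ring
      · rw [if_neg htM, if_neg htM, hμM t (by omega)]
        by_cases htj : t < j' + 1
        · rw [if_pos htj, hship]; ring
        · rw [if_neg htj]; ring
  · -- validity
    rintro (p | h) hpos
    · dsimp only [Sum.elim_inl] at hpos ⊢
      have hp : 0 < f p.1 p.2 := by
        by_contra hle
        have : f p.1 p.2 = 0 := le_antisymm (not_lt.1 hle) (hf0 _ _)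
        rw [this, zero_div] at hpos
        exact lt_irrefl _ hpos
      rw [if_pos hp, min_eq_left (hpair _ _ hp).1.le]
      obtain ⟨hlj, hl2, _, hc⟩ := hsupp _ _ hp
      by_cases hgi : j' + 1 ≤ (p.2 : ℕ)
      · simp only [gateOf, if_pos hgi]
        exact Or.inr (Or.inl ⟨(hpair _ _ hp).1, hgi, le_rfl⟩)
      · simp only [gateOf, if_neg hgi]
        exact validAt_creditPair x T _ _ j' (p.1 : ℕ) (p.2 : ℕ) (hpair _ _ hp).1 (by omega) hx1 rfl rfl
    · dsimp only [Sum.elim_inr] at hpos ⊢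
      refine Or.inl ⟨rfl, ?_⟩
      have hnl : ¬ ((h : ℕ) ≤ j' ∧ 2 * ((h : ℕ) : ℝ) < T) := by
        intro hl; rw [if_pos hl] at hpos; exact lt_irrefl _ hpos
      by_cases hj : j' + 1 ≤ (h : ℕ)
      · exact Or.inr hj
      · exact Or.inl (not_lt.1 fun hlt => hnl ⟨by omega, hlt⟩)

/-- **DEC(j′) AT TARGET `T` ⟺ THE FLOW FORM** (law `μ ≥ 0` on `{0..M}` of mass `1`, `0 < x < 1`). [this work] -/
theorem decAtT_iff_flowAtT (x T : ℝ) (j' M : ℕ) (μ : ℕ → ℝ) (hx0 : 0 < x) (hx1 : x < 1)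
    (hμM : ∀ h, M < h → μ h = 0) (hμ1 : ∑ h ∈ Finset.range (M + 1), μ h = 1) :
    DECAtT x T j' M μ ↔ FlowAtT x T j' M μ :=
  ⟨flowAtT_of_decAtT x T j' M μ hx0 hx1, decAtT_of_flowAtT x T j' M μ hx0 hx1 hμM hμ1⟩

/-- **DEC(j′) ⟺ THE FLOW FORM AT THE MEAN** (`Quant.LawDec.DECAt`). [this work] -/
theorem decAt_iff_flowAt (x : ℝ) (j' M : ℕ) (μ : ℕ → ℝ) (hx0 : 0 < x) (hx1 : x < 1)
    (hμM : ∀ h, M < h → μ h = 0) (hμ1 : ∑ h ∈ Finset.range (M + 1), μ h = 1) :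
    DECAt x j' M μ ↔ FlowAtT x (∑ h ∈ Finset.range (M + 1), (h : ℝ) * μ h) j' M μ := by
  rw [decAt_iff_decAtT]
  exact decAtT_iff_flowAtT x _ j' M μ hx0 hx1 hμM hμ1

end LawDec

end Quant

end Summit.CriticalPhenomena.PercolationContinuityZ3.Theorems
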